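import Summits.AnomalousDissipation.AnomalousDissipation.Theorems.SolenoidalFractalHomogenisationLagrangianStepVmodSSRegimesA
import HarnessLib

/-!
# K1L_D (stmt-AnomalousDissipation-27980): (V_mod) flat stage, block (fs) — SCALARS AND FLOOR ROWS for the (fs) assembly over
# `VmodFlat.fs_pairing_le_of_rows` (choice `L = g₀·n/⌈K/ν⌉`, `Kb = (K+1)/g₀`, `θL = 8π²·c·(lo/Λ)·M·Wp·g₀²/(K+1)²`; rows «floor»)
(helper; `--supports 27980 --as helper`; prover ad-k1loc-p3 g10.)

* `nu_mul_ceil_le` — `ν·⌈K/ν⌉₊ ≤ K + 1` (`0 < ν ≤ 1`, `0 ≤ K`);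
* `n_mul_nu_le_Kb_L` — `n·ν ≤ ((K+1)/g₀)·(g₀·n/⌈K/ν⌉₊)` (the `n·ν ≤ Kb·L` hypothesis of the W7 clause for the assembly's `L`, `Kb`);
* `thetaL_le` — `8π²·c·(lo/Λ)·(M·Wp)·g₀²/(K+1)² ≤ 8π²·loT lo Λ c ν n·(g₀ n/⌈K/ν⌉₊)²·(M·Wp/ν)` (the coarse rate of the lowest high label over
  one period is bounded below ν-uniformly — hypothesis `hθL` of `VmodFlat.leak_le_alw_of_high_fast`);
* `leak_le_alw_of_floor_fast` — the FLOOR ROW: when `ν₁ ≤ ν ≤ 1` and the slow weight is bounded below, `d₀ ≤ dW`, the trivial bound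
  `‖𝓕(U v)(ℓ)‖ ≤ ‖v‖` is paid by the floor term `C₁²ν^e` of the allowance as soon as `1 ≤ C₁²·ν₁^e·√d₀` (any contraction `U`).
`sorry`-free; NOT a proof of (fs), of the stub, of K1L_D or of AD; rung F-D1.A0.
-/

set_option linter.dupNamespace false

noncomputable section

namespace Summit.AnomalousDissipation.AnomalousDissipation.Theorems.SolenoidalFractalHomogenisation.LagrangianStep.VmodFlat

open Literature.Analysis Literature.Analysis.FluidPDE Literature.Analysis.FunctionSpaces
open MeasureTheory Set Filter UnitAddTorus
open scoped ENNReal NNReal InnerProductSpace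

/-! ## §1 Scalars of the class split -/

/-- `ν·⌈K/ν⌉₊ ≤ K + 1` for `0 < ν ≤ 1`, `0 ≤ K`. -/
theorem nu_mul_ceil_le {ν K : ℝ} (hν : 0 < ν) (hν1 : ν ≤ 1) (hK : 0 ≤ K) : ν * (⌈K / ν⌉₊ : ℝ) ≤ K + 1 := by
  have h1 := (Nat.ceil_lt_add_one (div_nonneg hK hν.le : 0 ≤ K / ν)).le
  calc ν * (⌈K / ν⌉₊ : ℝ) ≤ ν * (K / ν + 1) := mul_le_mul_of_nonneg_left h1 hν.le
    _ = K + ν := by field_simp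
    _ ≤ K + 1 := by linarith

/-- `n·ν ≤ Kb·L` for `Kb = (K+1)/g₀`, `L = g₀·n/⌈K/ν⌉₊`. -/
theorem n_mul_nu_le_Kb_L {ν K g₀ : ℝ} {n : ℕ} (hν : 0 < ν) (hν1 : ν ≤ 1) (hK : 0 < K) (hg₀ : 0 < g₀) :
    (n : ℝ) * ν ≤ ((K + 1) / g₀) * (g₀ * n / (⌈K / ν⌉₊ : ℝ)) := by
  have hc0 : (0:ℝ) < ⌈K / ν⌉₊ := by exact_mod_cast Nat.ceil_pos.2 (div_pos hK hν)
  have hg₀' : g₀ ≠ 0 := hg₀.ne'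
  have h1 := nu_mul_ceil_le hν hν1 hK.le
  rw [show ((K + 1) / g₀) * (g₀ * n / (⌈K / ν⌉₊ : ℝ)) = (n : ℝ) * ((K + 1) / (⌈K / ν⌉₊ : ℝ)) by field_simp]
  refine mul_le_mul_of_nonneg_left ?_ (Nat.cast_nonneg n)
  rw [le_div_iff₀ hc0]; linarith

/-- **The ν-uniform lower bound of the coarse rate of the lowest high label over one period.** -/
theorem thetaL_le {lo Λ c M Wp ν K g₀ : ℝ} {n : ℕ} (hlo : 0 < lo) (hΛ : 0 < Λ) (hc : 0 ≤ c) (hMW : 0 ≤ M * Wp)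
    (hν : 0 < ν) (hν1 : ν ≤ 1) (hK : 0 < K) (hn : 1 ≤ n) :
    8 * Real.pi ^ 2 * c * (lo / Λ) * (M * Wp) * g₀ ^ 2 / (K + 1) ^ 2
      ≤ 8 * Real.pi ^ 2 * loT lo Λ c ν n * (g₀ * n / (⌈K / ν⌉₊ : ℝ)) ^ 2 * (M * Wp / ν) := by
  have hn0 : (0:ℝ) < n := by exact_mod_cast (show 0 < n from hn)
  have hc0 : (0:ℝ) < ⌈K / ν⌉₊ := by exact_mod_cast Nat.ceil_pos.2 (div_pos hK hν)
  have hνc := nu_mul_ceil_le hν hν1 hK.le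
  have hνc0 : 0 < ν * (⌈K / ν⌉₊ : ℝ) := mul_pos hν hc0
  -- `loT ≥ (c/ν)(lo/Λ)/n²`
  have hloT : (1 / (n:ℝ) ^ 2) * ((c / ν) * (lo / Λ)) ≤ loT lo Λ c ν n := by
    unfold loT
    refine mul_le_mul_of_nonneg_left (mul_le_mul_of_nonneg_right (by linarith) (div_pos hlo hΛ).le) (by positivity)
  -- the right side with `loT` replaced by its lower bound equals `8π²c(lo/Λ)(M Wp) g₀² / (ν⌈K/ν⌉)²`
  have h1 : 8 * Real.pi ^ 2 * ((1 / (n:ℝ) ^ 2) * ((c / ν) * (lo / Λ))) * (g₀ * n / (⌈K / ν⌉₊ : ℝ)) ^ 2 * (M * Wp / ν)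
      = 8 * Real.pi ^ 2 * c * (lo / Λ) * (M * Wp) * g₀ ^ 2 / (ν * (⌈K / ν⌉₊ : ℝ)) ^ 2 := by
    field_simp
  have h2 : 8 * Real.pi ^ 2 * c * (lo / Λ) * (M * Wp) * g₀ ^ 2 / (K + 1) ^ 2
      ≤ 8 * Real.pi ^ 2 * c * (lo / Λ) * (M * Wp) * g₀ ^ 2 / (ν * (⌈K / ν⌉₊ : ℝ)) ^ 2 := by
    refine div_le_div_of_nonneg_left (by positivity) (by positivity) ?_
    exact pow_le_pow_left₀ hνc0.le hνc 2
  refine h2.trans ?_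
  rw [← h1]
  have hsq : 0 ≤ (g₀ * n / (⌈K / ν⌉₊ : ℝ)) ^ 2 * (M * Wp / ν) := by positivity
  have := mul_le_mul_of_nonneg_right (mul_le_mul_of_nonneg_left hloT (by positivity : (0:ℝ) ≤ 8 * Real.pi ^ 2)) hsq
  linarith [this]

/-! ## §2 The floor row -/

/-- **FLOOR ROW** (any contraction `U`): `ν₁ ≤ ν`, `d₀ ≤ dW`, `1 ≤ C₁²·ν₁^e·√d₀`, `0 ≤ e` ⇒ the trivial bound `‖𝓕(U v)(ℓ)‖ ≤ ‖v‖` is within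
the allowance (paid by the floor term `C₁²ν^e`). -/
theorem leak_le_alw_of_floor_fast {lo Λ c ν ν₁ K M Wp C₁ e d₀ : ℝ} {n : ℕ} (U : V2 →L[ℝ] V2) (hU : ∀ y, ‖U y‖ ≤ ‖y‖)
    (hν₁ : 0 < ν₁) (hν₁ν : ν₁ ≤ ν) (he0 : 0 ≤ e) (hC₁ : 0 ≤ C₁)
    {s t : ℝ} (hPτ : 0 ≤ (M * Wp / ν) / (t - s)) {ℓ : Fin 3 → ℤ} (hd : d₀ ≤ dW lo Λ c ν n (t - s) ℓ)
    (hfloor : 1 ≤ C₁ * C₁ * ν₁ ^ e * Real.sqrt d₀) (v : V2) :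
    ‖fc (U v) ℓ‖
      ≤ (C₁ * (C₁ * (ν ^ e + ((⌈K / ν⌉₊ : ℝ) / n) ^ e) + (min 1 ((M * Wp / ν) / (t - s))) ^ e))
        * Real.sqrt (dW lo Λ c ν n (t - s) ℓ) * ‖v‖ := by
  have hν0 : 0 < ν := lt_of_lt_of_le hν₁ hν₁ν
  have hB := sum_norm_sq_fcoeff_le {ℓ} (U v)
  rw [Finset.sum_singleton] at hB
  have h1 : ‖fc (U v) ℓ‖ ≤ ‖v‖ := by
    calc ‖fc (U v) ℓ‖ = Real.sqrt (‖fc (U v) ℓ‖ ^ 2) := (Real.sqrt_sq (norm_nonneg _)).symm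
      _ ≤ Real.sqrt (‖U v‖ ^ 2) := Real.sqrt_le_sqrt hB
      _ = ‖U v‖ := Real.sqrt_sq (norm_nonneg _)
      _ ≤ ‖v‖ := hU v
  have hνe : ν₁ ^ e ≤ ν ^ e := Real.rpow_le_rpow hν₁.le hν₁ν he0
  have hνe0 : 0 ≤ ν ^ e := Real.rpow_nonneg hν0.le e
  have hue : 0 ≤ ((⌈K / ν⌉₊ : ℝ) / n) ^ e := Real.rpow_nonneg (by positivity) e
  have hme : 0 ≤ (min 1 ((M * Wp / ν) / (t - s))) ^ e := Real.rpow_nonneg (le_min zero_le_one hPτ) e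
  have hsd : Real.sqrt d₀ ≤ Real.sqrt (dW lo Λ c ν n (t - s) ℓ) := Real.sqrt_le_sqrt hd
  have hkey : 1 ≤ C₁ * C₁ * ν ^ e * Real.sqrt (dW lo Λ c ν n (t - s) ℓ) :=
    hfloor.trans (mul_le_mul (mul_le_mul_of_nonneg_left hνe (mul_nonneg hC₁ hC₁)) hsd (Real.sqrt_nonneg _) (by positivity))
  have halw : C₁ * C₁ * ν ^ e ≤ C₁ * (C₁ * (ν ^ e + ((⌈K / ν⌉₊ : ℝ) / n) ^ e) + (min 1 ((M * Wp / ν) / (t - s))) ^ e) := by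
    nlinarith [mul_nonneg (mul_nonneg hC₁ hC₁) hue, mul_nonneg hC₁ hme]
  calc ‖fc (U v) ℓ‖ ≤ 1 * ‖v‖ := by rw [one_mul]; exact h1
    _ ≤ (C₁ * C₁ * ν ^ e * Real.sqrt (dW lo Λ c ν n (t - s) ℓ)) * ‖v‖ := mul_le_mul_of_nonneg_right hkey (norm_nonneg _)
    _ ≤ _ := mul_le_mul_of_nonneg_right (mul_le_mul_of_nonneg_right halw (Real.sqrt_nonneg _)) (norm_nonneg _)

end Summit.AnomalousDissipation.AnomalousDissipation.Theorems.SolenoidalFractalHomogenisation.LagrangianStep.VmodFlat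

end
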